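import Summits.ValiantsHypothesis.ValiantsHypothesis.Theorems.KPlusLogSqLawTropicalBMarkedEdgeExchange
import Mathlib.Algebra.BigOperators.Fin

/-!
# Route «KPlusLogSqLaw», crux `TropicalB` (stmt-ValiantsHypothesis-19771) — MARKED-EDGE sector:
# k-FACTOR RIGIDITY for any number of dominant covers (Abel summation over `Fin k`)

HONEST FRAMING.  Helper file (cell `pub-symmetroid`, seat val-sym-trop-p4 (g17), 2026-08-28; `--supports stmt-ValiantsHypothesis-19771
--as helper`).  General-`k` version of `factors_eq` (g16, k = 3) and `four_factors_eq(_le)` / `five_factors_eq_le` (this seat, p655398 /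
p657110): the numerical («Karamata») half of every exchange law of the sector whose certificate is a re-factorisation of the arc multiset
of `k` dominant covers, listed with repetition in weakly increasing slope order.  Motivation: the located certificates for the nested-triangle
core (memo LAYER2-CORE-g17.md) have up to five terms at `m ≤ 8` and no bound on their length is known for larger `m`.  Nothing here concerns
`TropicalB` in its window, `WeakLifting`, the doors, `MatrixDescartes` (stmt-ValiantsHypothesis-18050) or VP ≠ VNP.

Setting as in `…MarkedEdgeExchange` (inline, no definitions): covers `σ : Equiv.Perm V`, presence `ok`, weights `w`, slopes `g`, score at
`θ` = `∑ i, (w i (σ i) + θ * g i (σ i))`, unique maximiser at `θ`.  A `k`-fold factorisation is recorded pointwise by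
`List.Perm (List.ofFn fun r => F r i) (List.ofFn fun r => σ r i)`; suffix sums are written with `if` (`∑ s, if r ≤ s then … else 0`).
CONTENTS: `abel_lower_fin` (Abel summation: `θ` monotone, all suffix sums of `e` non-negative ⇒ `θ 0 · ∑ e ≤ ∑ θ r · e r`),
`abel_fin` (the equality conclusion), `ok_of_factorisation_fin`, `sum_eq_of_factorisation_fin`, **`factors_eq_fin`** (k-FACTOR RIGIDITY).
-/

set_option linter.dupNamespace false
set_option autoImplicit false

namespace Summit.ValiantsHypothesis.ValiantsHypothesis.Theorems.KPlusLogSqLaw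
namespace MarkedEdge
namespace FourBit

open Finset

/-! ### Abel summation over `Fin (k+1)` -/

/-- Abel summation, lower bound: if `θ` is monotone on `Fin (k+1)` and every suffix sum of `e` is non-negative, then
`θ 0 · (∑ e) ≤ ∑ r, θ r · e r`. [folklore: Abel summation] -/
theorem abel_lower_fin : ∀ (k : ℕ) (θ e : Fin (k + 1) → ℤ), Monotone θ →
    (∀ r : Fin (k + 1), 0 ≤ ∑ s, (if r ≤ s then e s else 0)) → θ 0 * (∑ s, e s) ≤ ∑ r, θ r * e r := by
  intro k
  induction k with
  | zero =>
    intro θ e _ _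
    simp
  | succ k ih =>
    intro θ e hθ hsuf
    -- split off the first term
    rw [Fin.sum_univ_succ e, Fin.sum_univ_succ (fun r => θ r * e r)]
    -- the tail data
    have hθ' : Monotone (fun r : Fin (k + 1) => θ r.succ) := fun a b hab => hθ (Fin.succ_le_succ_iff.mpr hab)
    have hsuf' : ∀ r : Fin (k + 1), 0 ≤ ∑ s, (if r ≤ s then e s.succ else 0) := by
      intro r
      have h := hsuf r.succ
      rw [Fin.sum_univ_succ] at h
      have h0 : (if r.succ ≤ (0 : Fin (k + 2)) then e 0 else 0) = 0 := by
        rw [if_neg]; exact fun hle => Fin.succ_ne_zero r (le_antisymm hle (Fin.zero_le _))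
      rw [h0, zero_add] at h
      have hre : ∀ s : Fin (k + 1), (if r.succ ≤ s.succ then e s.succ else 0) = (if r ≤ s then e s.succ else 0) := by
        intro s; simp only [Fin.succ_le_succ_iff]
      simpa only [hre] using h
    have hIH := ih (fun r => θ r.succ) (fun r => e r.succ) hθ' hsuf'
    -- the tail sum is non-negative (suffix sum at 0 of the tail)
    have hS1 : 0 ≤ ∑ s : Fin (k + 1), e s.succ := by
      have := hsuf' 0
      simpa using this
    have hθ01 : θ 0 ≤ θ (0 : Fin (k + 1)).succ := hθ (Fin.zero_le _)
    have hmul : θ 0 * ∑ s : Fin (k + 1), e s.succ ≤ θ (0 : Fin (k + 1)).succ * ∑ s : Fin (k + 1), e s.succ :=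
      mul_le_mul_of_nonneg_right hθ01 hS1
    rw [mul_add]
    linarith

/-- Abel summation, equality form: weakly increasing `θ`, equal totals `∑ B = ∑ A`, `∑ y = ∑ x`, suffix domination
`∑_{s ≥ r} x s ≤ ∑_{s ≥ r} y s` for all `r`, and `B r + θ r · y r ≤ A r + θ r · x r` for all `r` force equality for all `r`.
[folklore: Abel summation / Karamata] -/
theorem abel_fin {k : ℕ} {θ A B x y : Fin k → ℤ} (hθ : Monotone θ)
    (hW : ∑ r, B r = ∑ r, A r) (hG : ∑ r, y r = ∑ r, x r)
    (hs : ∀ r : Fin k, ∑ s, (if r ≤ s then x s else 0) ≤ ∑ s, (if r ≤ s then y s else 0))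
    (h : ∀ r, B r + θ r * y r ≤ A r + θ r * x r) : ∀ r, B r + θ r * y r = A r + θ r * x r := by
  cases k with
  | zero => intro r; exact Fin.elim0 r
  | succ k =>
    -- Abel summation on e = y - x
    have hsuf : ∀ r : Fin (k + 1), 0 ≤ ∑ s, (if r ≤ s then (y s - x s) else 0) := by
      intro r
      have hsplit : ∑ s, (if r ≤ s then (y s - x s) else 0)
          = (∑ s, (if r ≤ s then y s else 0)) - ∑ s, (if r ≤ s then x s else 0) := by
        rw [← Finset.sum_sub_distrib]
        refine Finset.sum_congr rfl fun s _ => ?_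
        split_ifs <;> simp
      rw [hsplit]; linarith [hs r]
    have hab := abel_lower_fin k θ (fun s => y s - x s) hθ hsuf
    have he0 : ∑ s : Fin (k + 1), (y s - x s) = 0 := by rw [Finset.sum_sub_distrib]; linarith
    rw [he0, mul_zero] at hab
    -- the non-negative gaps sum to a non-positive number
    have hgap : ∀ r, 0 ≤ (A r + θ r * x r) - (B r + θ r * y r) := fun r => by linarith [h r]
    have hsum : ∑ r, ((A r + θ r * x r) - (B r + θ r * y r)) ≤ 0 := by
      have e1 : ∑ r, ((A r + θ r * x r) - (B r + θ r * y r))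
          = (∑ r, A r) - (∑ r, B r) - ∑ r, θ r * (y r - x r) := by
        rw [← Finset.sum_sub_distrib, ← Finset.sum_sub_distrib]
        refine Finset.sum_congr rfl fun r _ => ?_
        ring
      rw [e1]; linarith
    have hzero := (Finset.sum_eq_zero_iff_of_nonneg fun r _ => hgap r).mp (le_antisymm hsum (Finset.sum_nonneg fun r _ => hgap r))
    intro r
    have := hzero r (Finset.mem_univ r)
    linarith

variable {V : Type*} [Fintype V] [DecidableEq V]

omit [Fintype V] [DecidableEq V] in
/-- A factor of a `k`-fold factorisation of present covers is present. [folklore] -/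
theorem ok_of_factorisation_fin (ok : V → V → Prop) {k : ℕ} {σ F : Fin k → Equiv.Perm V}
    (hP : ∀ i, List.Perm (List.ofFn fun r => F r i) (List.ofFn fun r => σ r i)) (hσ : ∀ r i, ok i (σ r i)) :
    ∀ r i, ok i (F r i) := by
  intro r i
  have hmem : F r i ∈ List.ofFn fun s => F s i := by
    rw [List.mem_ofFn]; exact ⟨r, rfl⟩
  have hmem' := (hP i).mem_iff.mp hmem
  rw [List.mem_ofFn] at hmem'
  obtain ⟨s, hs⟩ := hmem'
  rw [← hs]; exact hσ s i

omit [DecidableEq V] in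
/-- Weight (or slope) conservation along a `k`-fold factorisation. [folklore] -/
theorem sum_eq_of_factorisation_fin (f : V → V → ℤ) {k : ℕ} {σ F : Fin k → Equiv.Perm V}
    (hP : ∀ i, List.Perm (List.ofFn fun r => F r i) (List.ofFn fun r => σ r i)) :
    ∑ r, ∑ i, f i (F r i) = ∑ r, ∑ i, f i (σ r i) := by
  rw [Finset.sum_comm, Finset.sum_comm (f := fun r i => f i (σ r i))]
  refine Finset.sum_congr rfl fun i _ => ?_
  have h := ((hP i).map (f i)).sum_eq
  rw [List.map_ofFn, List.map_ofFn, List.sum_ofFn, List.sum_ofFn] at h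
  exact h

/-- **k-FACTOR RIGIDITY.**  Let `σ r` (`r : Fin k`) be unique maximisers (among present covers) at weakly increasing parameters `θ r`
(repetitions allowed), and let `(F r)` be a factorisation of the arc multiset `⊎ σ r` (pointwise `List.Perm` of the `List.ofFn`s) whose
slope suffix sums dominate: `∑_{s ≥ r} slope (σ s) ≤ ∑_{s ≥ r} slope (F s)` for every `r`.  Then `F r = σ r` for every `r`.  In words:
no re-factorisation of any multiset of dominant covers has a (suitably ordered) slope type that majorises theirs and differs from it.
[this seat's lemma; Abel summation `abel_fin`, presence, conservation, uniqueness of the maximisers] -/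
theorem factors_eq_fin (ok : V → V → Prop) (w g : V → V → ℤ) {k : ℕ} {θ : Fin k → ℤ} (hθ : Monotone θ)
    {σ F : Fin k → Equiv.Perm V}
    (hmax : ∀ r, (∀ i, ok i (σ r i)) ∧ ∀ τ : Equiv.Perm V, τ ≠ σ r → (∀ i, ok i (τ i)) →
      ∑ i, (w i (τ i) + θ r * g i (τ i)) < ∑ i, (w i (σ r i) + θ r * g i (σ r i)))
    (hP : ∀ i, List.Perm (List.ofFn fun r => F r i) (List.ofFn fun r => σ r i))
    (hs : ∀ r : Fin k, ∑ s, (if r ≤ s then (∑ i, g i (σ s i)) else 0) ≤ ∑ s, (if r ≤ s then (∑ i, g i (F s i)) else 0)) :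
    ∀ r, F r = σ r := by
  have hok : ∀ r i, ok i (F r i) := ok_of_factorisation_fin ok hP fun r => (hmax r).1
  have hW := sum_eq_of_factorisation_fin w hP
  have hG := sum_eq_of_factorisation_fin g hP
  have hle : ∀ r, (∑ i, w i (F r i)) + θ r * ∑ i, g i (F r i) ≤ (∑ i, w i (σ r i)) + θ r * ∑ i, g i (σ r i) :=
    fun r => score_le_of_isMax ok w g (hmax r) (hok r)
  have heq := abel_fin (A := fun r => ∑ i, w i (σ r i)) (B := fun r => ∑ i, w i (F r i))
    (x := fun r => ∑ i, g i (σ r i)) (y := fun r => ∑ i, g i (F r i)) hθ hW hG hs hle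
  intro r
  by_contra hne
  exact absurd (heq r) (ne_of_lt (score_lt_of_isMax ok w g (hmax r) (hok r) hne))

end FourBit
end MarkedEdge
end Summit.ValiantsHypothesis.ValiantsHypothesis.Theorems.KPlusLogSqLaw
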